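import Literature.NumberTheory.Irrationality.LaiLupuSprang2025.RationalFunction
import Literature.NumberTheory.Irrationality.Lai2025TwoAdic.PhiRefinement
import Literature.NumberTheory.DiophantineApproximation.FactorialRatioPrimeClasses
import HarnessLib

/-!
# Lai–Lupu–Sprang 2025, §5 (second half): the arithmetic factor `Φ_n = ∏_{√(pn) < q ≤ n} q^{φ(n/q)}` and the refined
# integrality `Φ_n^{−1} d_n^{p−1+s−i} r_{i,k} ∈ ℤ` (Lemma 5.4), `Φ_n^{−1} d_n^{p−1+s−i} ρ_i ∈ ℤ` (Lemma 5.5),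
# `Φ_n^{−1} d_n^{p−1+s} ρ_{0,j/p} ∈ ℤ` (Lemma 5.6), `Φ_n^{−1} d_n^{p−1+s} ρ_0 ∈ ℤ` (Lemma 5.7) — PROVED

Topic `Literature/NumberTheory/Irrationality/LaiLupuSprang2025`.  Source: L. Lai, C. Lupu, J. Sprang, *On the irrationality
of certain `p`-adic zeta values*, Res. Math. Sci. 12 (2025) = arXiv:2505.23088 [LaiLupuSprang2025], §5 "Arithmetic
properties" (held text `paper:arxiv-2505.23088`, chunks p0007–p0008, read on the page).  PROOF FILE (definitions with bodies +
theorems; no named fact, net debt 0): second file of the discharge of the tree's named fact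
`PAdicZetaValues.laiLupuSprang2025_theorem11`, on top of the sibling `RationalFunction.lean` (`Rn`, `RnReg`, `pBrick`, `Acst`,
`coeffR`, `rho`, `rhoZeroJ`, `rhoZero`) and the tree's exact-exponent divided-derivative calculus of
`Lai2025TwoAdic/PhiRefinement.lean` (`isDOrdDiv_*_exact`).

## Source, as printed ([LaiLupuSprang2025, §5])

* **Lemma 5.4.** «For any `i ∈ {1,2,…,p−1+s}` and any `k ∈ {1,2,…,n}`, we have `Φ_n^{−1} d_n^{p−1+s−i} r_{i,k} ∈ ℤ`, where
  `Φ_n := ∏_{√(pn) < q ≤ n, q prime} q^{φ(n/q)}` [(5.4)], with the function `φ : ℝ → ℤ` defined by `φ(x) := 0` if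
  `{x} ∈ [0, 2/p)`, `j − 1` if `{x} ∈ [j/p, (j+1)/p)`, `j = 2, 3, …, p−1` [(5.5)].  Here `{x} = x − ⌊x⌋`.»
  *Proof.* «Replacing `i` by `p−1+s−i`, we need to prove that `Φ_n^{−1} d_n^i r_{p−1+s−i,k} ∈ ℤ`, `i ∈ {0,1,…,p−2+s}` … It
  remains to prove that, for any prime `q` such that `√(pn) < q ≤ n` we have `v_q(r_{p−1+s−i,k}) ≥ φ(n/q) − i` [(5.8)]. …
  case `i = 0` … `r_{p−1+s,k} = R_n(t)(t+k)^{p−1+s}|_{t=−k} = k^{M₀} · (± binom(n,k))^s · (pk)!(pn−pk)!/(k!^p (n−k)!^p)`.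
  Since `q > √(pn)`, we have `v_q(r_{p−1+s,k}) ≥ v_q((pk)!(pn−pk)!/(k!^p(n−k)!^p)) = ⌊pk/q⌋ + ⌊(pn−pk)/q⌋ − p⌊k/q⌋ − p⌊(n−k)/q⌋`.
  It is elementary to check that, for any real numbers `x, y`, we have `⌊py⌋ + ⌊px−py⌋ − p⌊y⌋ − p⌊x−y⌋ ≥ φ(x)`. … Taking
  `x = n/q` and `y = k/q`, we obtain `v_q(r_{p−1+s,k}) ≥ φ(n/q)`.»  (Then the induction on `i` through the logarithmic
  derivative `U(t) = 𝒟_1(R_n(t)(t+k)^{p−1+s})/(R_n(t)(t+k)^{p−1+s}) = M₀/t + Σ_{ν≠pk} 1/(t+ν/p) − (p+s)Σ_{ν≠k} 1/(t+ν)`: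
  «Since `q > √(pn)`, each term … has `q`-adic order at least `−(m+1)`», and «`q > √(pn) > p+s > i` (since `n > (p+s)⁴`)».)
* **Lemma 5.5.** «`Φ_n^{−1} d_n^{p−1+s−i} ρ_i ∈ ℤ` … follows immediately from Eq. (4.3) and Lemma 5.4.»
* **Lemma 5.6.** «For any `j ∈ {1,…,p−1}`, we have `Φ_n^{−1} d_n^{p−1+s} ρ_{0,j/p} ∈ ℤ`.»  *Proof.* «It suffices to prove that
  for any pair of integers `(k,ν)` such that `0 ≤ ν < k ≤ n`, the most inner sum `Σ_i Φ_n^{−1}d_n^{p−1+s} r_{i,k}/(ν + j/p)^i`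
  is an integer.  We argue by contradiction. … the linear polynomial `t + k₀ − ν₀ − 1 + (p−j)/p` is a factor of
  `(t + (p−j)/p)_n`, and hence a factor of `R_n(t)`.  Thus `R_n(−k₀ + ν₀ + 1 − (p−j)/p) = 0`.  It follows from (def:r_ik)
  that `−Σ_i Σ_{k≠k₀} Φ_n^{−1}d_n^{p−1+s}r_{i,k}/(−k₀+ν₀+k+j/p)^i = Σ_i Φ_n^{−1}d_n^{p−1+s}r_{i,k₀}/(ν₀+j/p)^i ∉ ℤ`.  Therefore
  there exist a prime `q` and `i₀, i₁, k₁ ≠ k₀` with `v_q(…) < 0`, `v_q(…) < 0`.  On the other hand, by Lemma 5.4 …  It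
  follows that `v_q(−k₀+ν₀+k₁+j/p) > v_q(d_n)`, `v_q(ν₀+j/p) > v_q(d_n)`, and hence `v_q(k₁−k₀) > v_q(d_n)`.  But this
  contradicts `0 < |k₁−k₀| ≤ n`.»
* **Lemma 5.7.** «`Φ_n^{−1} d_n^{p−1+s} ρ_0 ∈ ℤ` … follows immediately from Eq. (4.8) and Lemma 5.6.»

## What is formalised (all PROVED; `p` prime where needed, `q` the auxiliary primes)

* `phiExp p n q = φ(n/q)` in integer arithmetic: `⌊p·(n mod q)/q⌋ ∸ 1` (`{n/q} ∈ [j/p,(j+1)/p)` iff `j = ⌊p(n mod q)/q⌋`);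
  `phiPrimes p n` (the primes `q ≤ n` with `pn < q²`) and **(5.4)** `PhiL p n = Φ_n := ∏ q^{φ(n/q)}`;
  `padicValNat_PhiL_of_mem` (`= φ(n/q)`), `padicValNat_PhiL_of_not_mem` (`= 0`), `padicValNat_lcmUpto_of_mem_phiPrimes` (`= 1`).
* The printed floor inequality in the form used: `floor_ineq` —
  `⌊pk/q⌋ + ⌊p(n−k)/q⌋ ≥ p⌊k/q⌋ + p⌊(n−k)/q⌋ + φ(n/q)` (`q > 0`).
* **The `i = 0` display**: `Acst_mul_prod_pBrick_neg` (`A·∏_j F_{j/p}(−k) = ±(pk)!(p(n−k))!/(k!(n−k)! n!^{p−1})`, through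
  `prod_prod_linear_eq` — the punctured factorial `∏_{m<M}∏_{j=1}^{p−1}(pm+j) = (pM)!/(p^M M!)`), `RnReg_neg_eq`
  (`r_{p−1+s,k} = ± k^{M₀} binom(n,k)^s (pk)!(p(n−k))!/(k!^p(n−k)!^p)`), and `phiExp_le_padicValRat_RnReg_neg`
  (`v_q(r_{p−1+s,k}) ≥ φ(n/q)` for `pn < q²`, `1 ≤ k ≤ n`, one Legendre digit per factorial).
* **(5.8) for every `i`**, `padicOrdGe_coeffR_of_mem_phiPrimes`: `v_q(r_{i,k}) ≥ φ(n/q) − (p−1+s−i)` for `q ∈ phiPrimes p n`,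
  `1 ≤ k ≤ n`.  DEVIATION (flagged, the same bookkeeping as the tree's `Lai2025TwoAdic/PhiRefinement.lean`): instead of the
  induction through the logarithmic derivative `U`, the brick form `A·t^{M₀}·(G(t)(t+k))^{p−1+s}·∏_j F_{j/p}` is fed to the
  exact-exponent divided-derivative calculus `IsDOrdDiv` — each linear factor `t + j/p + m`, `t`, `(t+l)^{−1}` loses at most one
  `q` per derivative because `q² > pn ≥ |p(m−k)+j|, k, |l−k|` (exactly the content of «each term has `q`-adic order at least
  `−(m+1)`»), so `v_q(𝒟_λ(R_n(t)(t+k)^{p−1+s})(−k)) ≥ v_q(r_{p−1+s,k}) − λ`; the hypothesis `n > (p+s)⁴` (used in print only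
  for `q > i`, i.e. `v_q(i!) = 0`) is therefore NOT needed: divided derivatives carry no `i!`.  At `k = 0` all `r_{i,0}` vanish
  (`coeffR_zero_right`, the factor `t^{M₀}`).
* **Lemma 5.4** `exists_int_phi_coeffR` (`Φ_n^{−1}d_n^{p−1+s−i}r_{i,k} ∈ ℤ`, `k ≤ n`, `p ≥ 2`, `s ≥ 1`), prime by prime;
  **Lemma 5.5** `exists_int_phi_rho`, `exists_int_phi_rho'` (with `d_n^{p−1+s}`).
* `XtermR p s n k y := Σ_i r_{i,k} y^{−i}`, `rhoZeroJ_eq` (`ρ_{0,j/p} = −Σ_k Σ_{ν<k} X_k(ν + j/p)`), the root relation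
  `sum_XtermR_root_eq_zero` (`R_n(j/p − m) = 0`, `1 ≤ m ≤ n`, through (def:r_ik)), `not_dvd_both_p` (no two bad shifts
  `pν + j`, `p(k'−k+ν) + j`), **Lemma 5.6** `exists_int_phi_XtermR` / `exists_int_phi_rhoZeroJ`, **Lemma 5.7**
  `exists_int_phi_rhoZero` — the printed argument by contradiction, run as "every term is `q`-integral at every prime `q`".

Cell zeta5-irr / pub-zeta5 (HONEST FRAMING: systematic search; no irrationality claim unless kernel-certified): auxiliary
`p`-adic material for a RECORD entry; nothing here bears on `ζ(5) ∈ ℝ`.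
-/

noncomputable section

open Finset Filter Literature.Analysis.Calculus
open Literature.NumberTheory.Transcendental
open Literature.NumberTheory.Irrationality.RivoalZudilin2020 (Greg Greg_eq Greg_isDInt)
open Literature.NumberTheory.Irrationality.LaiSprangZudilin2026.Lemma53 (Greg_neg)
open Literature.NumberTheory.Irrationality.Lai2025TwoAdic (isDOrdDiv_mul_exact isDOrdDiv_pow_exact isDOrdDiv_prod_exact
  isDOrdDiv_const_exact isDOrdDiv_add_const_exact isDOrdDiv_Greg_exact Greg_neg_ne_zero pow_log_succ_dvd_of_one_lt_padicNorm
  padicNorm_lcmUpto contDiffAt_Greg)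
open Literature.NumberTheory.DiophantineApproximation.RhinViola (padicValNat_factorial_of_lt_sq)
open scoped Nat Topology

namespace Literature.NumberTheory.Irrationality.LaiLupuSprang2025

/-! ## §1. The arithmetic factor `Φ_n` ((5.4), (5.5)) -/

/-- `φ(n/q)` for (5.5): `{n/q} = (n mod q)/q ∈ [j/p, (j+1)/p)` iff `j = ⌊p(n mod q)/q⌋`, and `φ = j − 1` for `j ≥ 2`, `0` for
`j ≤ 1`, i.e. `φ(n/q) = ⌊p(n mod q)/q⌋ ∸ 1`. [cite: LaiLupuSprang2025, Lemma 5.4 (5.5)] -/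
def phiExp (p n q : ℕ) : ℕ := p * (n % q) / q - 1

/-- The primes of `Φ_n`: `q` prime, `q ≤ n`, `√(pn) < q` (`pn < q²`). [cite: LaiLupuSprang2025, Lemma 5.4 (5.4)] -/
def phiPrimes (p n : ℕ) : Finset ℕ := (range (n + 1)).filter fun q => q.Prime ∧ p * n < q * q

/-- **`Φ_n := ∏_{√(pn) < q ≤ n, q prime} q^{φ(n/q)}`** ((5.4)). [cite: LaiLupuSprang2025, Lemma 5.4 (5.4)] -/
def PhiL (p n : ℕ) : ℕ := ∏ q ∈ phiPrimes p n, q ^ phiExp p n q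

/-- Membership in `phiPrimes`. [cite: LaiLupuSprang2025, Lemma 5.4 (5.4)] -/
theorem mem_phiPrimes {p n q : ℕ} : q ∈ phiPrimes p n ↔ q ≤ n ∧ q.Prime ∧ p * n < q * q := by
  simp [phiPrimes]

/-- `Φ_n > 0`. [cite: LaiLupuSprang2025, Lemma 5.4 (5.4)] -/
theorem PhiL_pos (p n : ℕ) : 0 < PhiL p n :=
  prod_pos fun _ hq => pow_pos (mem_phiPrimes.1 hq).2.1.pos _

/-- `(Φ_n : ℚ) ≠ 0`. [cite: LaiLupuSprang2025, Lemma 5.4 (5.4)] -/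
theorem PhiL_cast_ne_zero (p n : ℕ) : (PhiL p n : ℚ) ≠ 0 := by exact_mod_cast (PhiL_pos p n).ne'

/-- `q` does not divide the part of `Φ_n` coming from the other primes. [cite: LaiLupuSprang2025, Lemma 5.4 (5.4)] -/
private theorem padicValNat_prod_erase_eq_zero {p n q : ℕ} [hq : Fact q.Prime] :
    padicValNat q (∏ r ∈ (phiPrimes p n).erase q, r ^ phiExp p n r) = 0 := by
  refine padicValNat.eq_zero_of_not_dvd fun hdvd => ?_
  obtain ⟨r, hr, hqr⟩ := (Prime.dvd_finsetProd_iff hq.out.prime _).1 hdvd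
  have hrp : r.Prime := (mem_phiPrimes.1 (mem_of_mem_erase hr)).2.1
  have := (Nat.prime_dvd_prime_iff_eq hq.out hrp).1 (hq.out.dvd_of_dvd_pow hqr)
  exact (mem_erase.1 hr).1 this.symm

/-- `v_q(Φ_n) = φ(n/q)` for `q ∈ phiPrimes p n`. [cite: LaiLupuSprang2025, Lemma 5.4 (5.4)] -/
theorem padicValNat_PhiL_of_mem {p n q : ℕ} [hq : Fact q.Prime] (h : q ∈ phiPrimes p n) :
    padicValNat q (PhiL p n) = phiExp p n q := by
  classical
  rw [PhiL, ← mul_prod_erase _ _ h, padicValNat.mul (pow_ne_zero _ hq.out.ne_zero)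
    (prod_ne_zero_iff.2 fun r hr => pow_ne_zero _ (mem_phiPrimes.1 (mem_of_mem_erase hr)).2.1.ne_zero),
    padicValNat.prime_pow, padicValNat_prod_erase_eq_zero, add_zero]

/-- `v_q(Φ_n) = 0` for a prime `q ∉ phiPrimes p n`. [cite: LaiLupuSprang2025, Lemma 5.4 (5.4)] -/
theorem padicValNat_PhiL_of_not_mem {p n q : ℕ} [hq : Fact q.Prime] (h : q ∉ phiPrimes p n) :
    padicValNat q (PhiL p n) = 0 := by
  refine padicValNat.eq_zero_of_not_dvd fun hdvd => ?_
  obtain ⟨r, hr, hqr⟩ := (Prime.dvd_finsetProd_iff hq.out.prime _).1 hdvd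
  have hrp : r.Prime := (mem_phiPrimes.1 hr).2.1
  have := (Nat.prime_dvd_prime_iff_eq hq.out hrp).1 (hq.out.dvd_of_dvd_pow hqr)
  exact h (this ▸ hr)

/-- For `q ∈ phiPrimes p n` with `p ≥ 1`: `q ≤ n < q²`, hence `v_q(d_n) = ⌊log_q n⌋ = 1`.
[cite: LaiLupuSprang2025, Lemma 5.6 (proof: "v_q(k₁ − k₀) > v_q(d_n). But this contradicts 0 < |k₁−k₀| ≤ n")] -/
theorem padicValNat_lcmUpto_of_mem_phiPrimes {p n q : ℕ} [hq : Fact q.Prime] (hp : 1 ≤ p) (h : q ∈ phiPrimes p n) :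
    padicValNat q (Nat.lcmUpto n) = 1 := by
  obtain ⟨hqn, -, hpn⟩ := mem_phiPrimes.1 h
  rw [Zudilin2004.padicValNat_lcmUpto]
  have hn : n < q ^ 2 := by nlinarith
  have h1 : q ^ 1 ≤ n := by simpa using hqn
  exact le_antisymm (Nat.lt_succ_iff.1 (Nat.log_lt_of_lt_pow' (by omega) hn)) (Nat.le_log_of_pow_le hq.out.one_lt h1)

/-- Bounds for `q ∈ phiPrimes p n` (`p ≥ 1`): `n < q²`, `1 ≤ n`, `q ≠ p` is not needed below but `2 ≤ q`.
[cite: LaiLupuSprang2025, Lemma 5.4 (the range √(pn) < q ≤ n)] -/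
theorem phiPrimes_bounds {p n q : ℕ} (hp : 1 ≤ p) (h : q ∈ phiPrimes p n) : q ≤ n ∧ n < q * q ∧ 1 ≤ n ∧ 2 ≤ q := by
  obtain ⟨hqn, hqp, hpn⟩ := mem_phiPrimes.1 h
  refine ⟨hqn, by nlinarith, ?_, hqp.two_le⟩
  rcases Nat.eq_zero_or_pos n with rfl | hn
  · exact absurd hqn (by have := hqp.two_le; omega)
  · exact hn

/-! ## §2. The floor inequality and the value `r_{p−1+s,k}` -/

/-- **The floor inequality** («`⌊py⌋ + ⌊px−py⌋ − p⌊y⌋ − p⌊x−y⌋ ≥ φ(x)`» at `x = n/q`, `y = k/q`), in natural-number form: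
`⌊pk/q⌋ + ⌊p(n−k)/q⌋ ≥ p⌊k/q⌋ + p⌊(n−k)/q⌋ + φ(n/q)` (`k ≤ n`, `q > 0`).
[cite: LaiLupuSprang2025, Lemma 5.4 (proof, case i = 0)] -/
theorem floor_ineq (p : ℕ) {n k q : ℕ} (hq : 0 < q) (hk : k ≤ n) :
    p * (k / q) + p * ((n - k) / q) + phiExp p n q ≤ p * k / q + p * (n - k) / q := by
  set a := k / q with ha
  set b := (n - k) / q with hb
  set y := k % q with hy
  set z := (n - k) % q with hz
  have hk' : k = q * a + y := (Nat.div_add_mod k q).symm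
  have hnk' : n - k = q * b + z := (Nat.div_add_mod (n - k) q).symm
  have e1 : p * k / q = p * a + p * y / q := by
    rw [hk', show p * (q * a + y) = p * y + p * a * q by ring, Nat.add_mul_div_right _ _ hq]; ring
  have e2 : p * (n - k) / q = p * b + p * z / q := by
    rw [hnk', show p * (q * b + z) = p * z + p * b * q by ring, Nat.add_mul_div_right _ _ hq]; ring
  have hmod : n % q = (y + z) % q := by
    have hn : n = k + (n - k) := (Nat.add_sub_cancel' hk).symm
    rw [hnk'] at hn
    rw [hk'] at hn
    have hn' : n = (y + z) + q * (a + b) := by rw [hn]; ring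
    rw [hn', Nat.add_mul_mod_self_left]
  have key : p * (n % q) / q ≤ p * y / q + p * z / q + 1 := by
    rw [hmod]
    calc p * ((y + z) % q) / q ≤ p * (y + z) / q := Nat.div_le_div_right (Nat.mul_le_mul_left _ (Nat.mod_le _ _))
      _ = (p * y + p * z) / q := by rw [mul_add]
      _ ≤ p * y / q + p * z / q + 1 := by
          rw [Nat.add_div hq]; split_ifs <;> omega
  rw [e1, e2, phiExp]
  generalize p * y / q = Y at key ⊢
  generalize p * z / q = Z at key ⊢
  generalize p * (n % q) / q = W at key ⊢
  omega

/-- The punctured factorial: `(∏_{m<M} ∏_{j=1}^{p−1} (pm + j)) · p^M · M! = (pM)!` (`p ≥ 1`).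
[cite: LaiLupuSprang2025, Lemma 5.4 (proof: r_{p−1+s,k} = … (pk)!(pn−pk)!/(k!^p(n−k)!^p))] -/
theorem prod_prod_linear_mul (p : ℕ) (hp : 1 ≤ p) (M : ℕ) :
    (∏ m ∈ range M, ∏ j ∈ Ico 1 p, (p * m + j)) * (p ^ M * M !) = (p * M)! := by
  induction M with
  | zero => simp
  | succ M ih =>
    rw [prod_range_succ, Nat.factorial_succ, pow_succ, show p * (M + 1) = p * M + p by ring]
    -- `(pM + p)! = (pM)! · ∏_{i=1}^{p} (pM + i)` and `∏_{i=1}^{p} = (∏_{j=1}^{p-1}) · (pM + p)`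
    have hsplit : (p * M + p)! = (p * M)! * ∏ i ∈ Ico 1 (p + 1), (p * M + i) := by
      have : ∀ r : ℕ, (p * M + r)! = (p * M)! * ∏ i ∈ Ico 1 (r + 1), (p * M + i) := by
        intro r
        induction r with
        | zero => simp
        | succ r ihr =>
          rw [show p * M + (r + 1) = (p * M + r) + 1 by ring, Nat.factorial_succ, ihr,
            Finset.prod_Ico_succ_top (by omega : 1 ≤ r + 1)]
          ring
      exact this p
    rw [hsplit, Finset.prod_Ico_succ_top hp, ← ih]
    ring

/-- The same in `ℚ`: `∏_{m<M}∏_{j=1}^{p−1}(pm + j) = (pM)!/(p^M M!)`. [cite: LaiLupuSprang2025, Lemma 5.4 (proof, case i = 0)] -/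
theorem prod_prod_linear_eq (p : ℕ) (hp : 1 ≤ p) (M : ℕ) :
    (∏ m ∈ range M, ∏ j ∈ Ico 1 p, ((p : ℚ) * m + j)) = ((p * M)! : ℚ) / ((p : ℚ) ^ M * (M ! : ℚ)) := by
  have h := prod_prod_linear_mul p hp M
  have hden : (p : ℚ) ^ M * (M ! : ℚ) ≠ 0 :=
    mul_ne_zero (pow_ne_zero _ (by exact_mod_cast (show p ≠ 0 by omega))) (by exact_mod_cast Nat.factorial_ne_zero M)
  rw [eq_div_iff hden]
  exact_mod_cast h

/-- Reflection of the inner product: `∏_{j=1}^{p−1}(−(c + p) + j) = (−1)^{p−1} ∏_{j=1}^{p−1}(c + j)` (`j ↦ p − j`).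
[cite: LaiLupuSprang2025, Lemma 5.4 (proof, case i = 0)] -/
theorem prod_Ico_neg_reflect (p : ℕ) (c : ℚ) :
    ∏ j ∈ Ico 1 p, (-(c + p) + j) = (-1) ^ (p - 1) * ∏ j ∈ Ico 1 p, (c + j) := by
  have hbij : ∏ j ∈ Ico 1 p, (-(c + p) + (j : ℚ)) = ∏ j ∈ Ico 1 p, (-(c + (j : ℚ))) := by
    refine prod_nbij' (fun j => p - j) (fun j => p - j) ?_ ?_ ?_ ?_ ?_
    · intro j hj; have := mem_Ico.1 hj; exact mem_Ico.2 ⟨by omega, by omega⟩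
    · intro j hj; have := mem_Ico.1 hj; exact mem_Ico.2 ⟨by omega, by omega⟩
    · intro j hj; have := mem_Ico.1 hj; omega
    · intro j hj; have := mem_Ico.1 hj; omega
    · intro j hj; have := mem_Ico.1 hj
      rw [Nat.cast_sub (by omega : j ≤ p)]; ring
  rw [hbij]
  calc ∏ j ∈ Ico 1 p, (-(c + (j : ℚ))) = ∏ j ∈ Ico 1 p, ((-1) * (c + j)) := prod_congr rfl fun j _ => by ring
    _ = (∏ _j ∈ Ico 1 p, (-1 : ℚ)) * ∏ j ∈ Ico 1 p, (c + j) := prod_mul_distrib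
    _ = (-1) ^ (p - 1) * ∏ j ∈ Ico 1 p, (c + j) := by rw [prod_const, Nat.card_Ico]

/-- The double product of the linear factors at `−k`:
`∏_{j=1}^{p−1} ∏_{m<n} (−k + j/p + m) = (−1)^{(p−1)k} (pk)!(p(n−k))! / (p^{pn} k!(n−k)!)` (`p ≥ 1`, `k ≤ n`).
[cite: LaiLupuSprang2025, Lemma 5.4 (proof, case i = 0)] -/
theorem prod_prod_neg_eq {p : ℕ} (hp : 1 ≤ p) {n k : ℕ} (hk : k ≤ n) :
    ∏ j ∈ Ico 1 p, ∏ m ∈ range n, (-(k : ℚ) + ((j : ℚ) / p + m)) =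
      (-1) ^ ((p - 1) * k) * (((p * k)! : ℚ) * ((p * (n - k))! : ℚ)) /
        ((p : ℚ) ^ (p * n) * ((k ! : ℚ) * ((n - k)! : ℚ))) := by
  have hp0 : (p : ℚ) ≠ 0 := by exact_mod_cast (show p ≠ 0 by omega)
  -- each factor is `(p(m−k) + j)/p`
  have e0 : ∀ j m : ℕ, (-(k : ℚ) + ((j : ℚ) / p + m)) = ((p : ℚ) * ((m : ℚ) - k) + j) / p := fun j m => by
    field_simp; ring
  have e1 : ∏ j ∈ Ico 1 p, ∏ m ∈ range n, (-(k : ℚ) + ((j : ℚ) / p + m)) =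
      (∏ m ∈ range n, ∏ j ∈ Ico 1 p, ((p : ℚ) * ((m : ℚ) - k) + j)) / (p : ℚ) ^ ((p - 1) * n) := by
    have s1 : ∏ j ∈ Ico 1 p, ∏ m ∈ range n, (-(k : ℚ) + ((j : ℚ) / p + m)) =
        ∏ j ∈ Ico 1 p, ((∏ m ∈ range n, ((p : ℚ) * ((m : ℚ) - k) + j)) / (p : ℚ) ^ n) := by
      refine prod_congr rfl fun j _ => ?_
      rw [prod_congr rfl fun m _ => e0 j m, prod_div_distrib, prod_const, card_range]
    rw [s1, prod_div_distrib, prod_const, Nat.card_Ico, ← pow_mul, Nat.mul_comm n (p - 1), Finset.prod_comm]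
  -- split the range at `k`
  have e2 : ∏ m ∈ range n, ∏ j ∈ Ico 1 p, ((p : ℚ) * ((m : ℚ) - k) + j) =
      (∏ m ∈ range k, ∏ j ∈ Ico 1 p, ((p : ℚ) * ((m : ℚ) - k) + j)) *
        ∏ m ∈ range (n - k), ∏ j ∈ Ico 1 p, ((p : ℚ) * m + j) := by
    rw [← prod_range_mul_prod_Ico _ hk, prod_Ico_eq_prod_range]
    congr 1
    refine prod_congr rfl fun m _ => prod_congr rfl fun j _ => ?_
    push_cast; ring
  -- the part `m < k`, reflected
  have e3 : ∏ m ∈ range k, ∏ j ∈ Ico 1 p, ((p : ℚ) * ((m : ℚ) - k) + j) =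
      (-1) ^ ((p - 1) * k) * ∏ m ∈ range k, ∏ j ∈ Ico 1 p, ((p : ℚ) * m + j) := by
    rw [← prod_range_reflect (fun m => ∏ j ∈ Ico 1 p, ((p : ℚ) * ((m : ℚ) - k) + j)) k]
    have h : ∀ m ∈ range k, ∏ j ∈ Ico 1 p, ((p : ℚ) * (((k - 1 - m : ℕ) : ℚ) - k) + j) =
        (-1) ^ (p - 1) * ∏ j ∈ Ico 1 p, ((p : ℚ) * m + j) := by
      intro m hm
      have hm' := mem_range.1 hm
      rw [← prod_Ico_neg_reflect p ((p : ℚ) * m)]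
      refine prod_congr rfl fun j _ => ?_
      rw [Nat.cast_sub (by omega : m ≤ k - 1), Nat.cast_sub (by omega : 1 ≤ k)]
      ring
    rw [prod_congr rfl h, prod_mul_distrib, prod_const, card_range, ← pow_mul]
  rw [e1, e2, e3, prod_prod_linear_eq p hp k, prod_prod_linear_eq p hp (n - k)]
  have hpk : (p : ℚ) ^ (p * n) = (p : ℚ) ^ ((p - 1) * n) * ((p : ℚ) ^ k * (p : ℚ) ^ (n - k)) := by
    rw [← pow_add, ← pow_add]
    congr 1
    obtain ⟨d, rfl⟩ : ∃ d, p = d + 1 := ⟨p - 1, by omega⟩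
    simp only [Nat.add_sub_cancel]
    have := Nat.add_sub_cancel' hk
    rw [this]; ring
  rw [hpk]
  field_simp

/-- **The `i = 0` display, constant part:** `A · ∏_{j=1}^{p−1} F_{j/p}(−k) = (−1)^{(p−1)k} (pk)!(p(n−k))!/(k!(n−k)! · n!^{p−1})`
(`p ≥ 1`, `k ≤ n`; all powers of `p` cancel). [cite: LaiLupuSprang2025, Lemma 5.4 (proof, case i = 0)] -/
theorem Acst_mul_prod_pBrick_neg {p : ℕ} (hp : 1 ≤ p) {n k : ℕ} (hk : k ≤ n) :
    (Acst p n : ℚ) * ∏ j ∈ Ico 1 p, pBrick p j n (-(k : ℚ)) =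
      (-1) ^ ((p - 1) * k) * (((p * k)! : ℚ) * ((p * (n - k))! : ℚ)) /
        ((k ! : ℚ) * ((n - k)! : ℚ) * (n ! : ℚ) ^ (p - 1)) := by
  have hp0 : (p : ℚ) ≠ 0 := by exact_mod_cast (show p ≠ 0 by omega)
  have hfac : (n ! : ℚ) ≠ 0 := by exact_mod_cast Nat.factorial_ne_zero n
  have hbr : ∏ j ∈ Ico 1 p, pBrick p j n (-(k : ℚ)) =
      ((p : ℚ) ^ n * (p : ℚ) ^ (n / (p - 1)) / (n ! : ℚ)) ^ (p - 1) *
        ∏ j ∈ Ico 1 p, ∏ m ∈ range n, (-(k : ℚ) + ((j : ℚ) / p + m)) := by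
    unfold pBrick
    rw [prod_mul_distrib, prod_const, Nat.card_Ico]
  rw [hbr, prod_prod_neg_eq hp hk, ← mul_assoc, show (Acst p n : ℚ) * ((p : ℚ) ^ n * (p : ℚ) ^ (n / (p - 1)) /
      (n ! : ℚ)) ^ (p - 1) = (Acst p n : ℚ) * ((p : ℚ) ^ n * (p : ℚ) ^ (n / (p - 1))) ^ (p - 1) / (n ! : ℚ) ^ (p - 1) by
    rw [div_pow]; ring, ← pow_mul_eq_Acst_mul hp n]
  field_simp

/-- `p − 1 + s < M₀` for `p ≥ 2`, `s ≥ 1` (strict form of «`M₀ > p − 1 + s`»). [cite: LaiLupuSprang2025, §3 (after Definition 3.2)] -/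
theorem pole_order_lt_M0 {p s : ℕ} (hp : 2 ≤ p) (hs : 1 ≤ s) : p - 1 + s < M0 p s := by
  unfold M0
  have h1 : p ^ 2 * s ≤ p ^ (2 + N0 p s) * s :=
    Nat.mul_le_mul_right _ (Nat.pow_le_pow_right (by omega) (by omega))
  have h3 : p + 2 ≤ p ^ 2 := by nlinarith
  have h4 : p ≤ p * s := Nat.le_mul_of_pos_right p hs
  have h2 : p + s + 1 ≤ p ^ 2 * s :=
    calc p + s + 1 ≤ p * s + s + s := by omega
      _ = (p + 2) * s := by ring
      _ ≤ p ^ 2 * s := Nat.mul_le_mul_right s h3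
  omega

/-- **The `i = 0` display:** `r_{p−1+s,k} = R_n(t)(t+k)^{p−1+s}|_{t=−k} = ± k^{M₀} n!^s (pk)!(p(n−k))!/(k!(n−k)!)^{p+s}`
`= ± k^{M₀} binom(n,k)^s (pk)!(p(n−k))!/(k!^p(n−k)!^p)` (`p ≥ 1`, `k ≤ n`).
[cite: LaiLupuSprang2025, Lemma 5.4 (proof, case i = 0)] -/
theorem RnReg_neg_eq {p : ℕ} (hp : 1 ≤ p) (s : ℕ) {n k : ℕ} (hk : k ≤ n) :
    RnReg p s n k (-(k : ℚ)) = (-1) ^ ((p - 1) * k + M0 p s + k * (p - 1 + s)) *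
      ((k : ℚ) ^ M0 p s * (n ! : ℚ) ^ s * (((p * k)! : ℚ) * ((p * (n - k))! : ℚ)) /
        ((k ! : ℚ) * ((n - k)! : ℚ)) ^ (p + s)) := by
  have hfac : (n ! : ℚ) ≠ 0 := by exact_mod_cast Nat.factorial_ne_zero n
  have hk1 : (k ! : ℚ) ≠ 0 := by exact_mod_cast Nat.factorial_ne_zero k
  have hk2 : ((n - k)! : ℚ) ≠ 0 := by exact_mod_cast Nat.factorial_ne_zero (n - k)
  rw [RnReg, show (Acst p n : ℚ) * (-(k : ℚ)) ^ M0 p s * Greg n k (-(k : ℚ)) ^ (p - 1 + s) *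
      ∏ j ∈ Ico 1 p, pBrick p j n (-(k : ℚ)) = ((Acst p n : ℚ) * ∏ j ∈ Ico 1 p, pBrick p j n (-(k : ℚ))) *
      ((-(k : ℚ)) ^ M0 p s * Greg n k (-(k : ℚ)) ^ (p - 1 + s)) by ring, Acst_mul_prod_pBrick_neg hp hk, Greg_neg n hk]
  obtain ⟨d, rfl⟩ : ∃ d, p = d + 1 := ⟨p - 1, by omega⟩
  simp only [Nat.add_sub_cancel]
  rw [neg_pow, div_pow, mul_pow, ← pow_mul]
  field_simp
  ring

/-- `v_q(a) ≤ v_q(b)` for naturals with `a ∣ b ≠ 0`. [folklore] -/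
private theorem padicValNat_le_of_dvd {q a b : ℕ} [Fact q.Prime] (hb : b ≠ 0) (h : a ∣ b) :
    padicValNat q a ≤ padicValNat q b := by
  have ha : a ≠ 0 := fun ha => hb (by rw [ha] at h; exact zero_dvd_iff.1 h)
  exact (padicValNat_dvd_iff_le hb).1 (dvd_trans pow_padicValNat_dvd h)

/-- **`v_q(r_{p−1+s,k}) ≥ φ(n/q)`** for a prime `q` with `pn < q²` and `1 ≤ k ≤ n` (`p ≥ 1`): one Legendre digit for each of
`(pk)!`, `(p(n−k))!`, `k!`, `(n−k)!`, the floor inequality, and `v_q(binom(n,k)^s) ≥ 0`.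
[cite: LaiLupuSprang2025, Lemma 5.4 (proof, case i = 0)] -/
theorem phiExp_le_padicValRat_RnReg_neg {p q : ℕ} [hq : Fact q.Prime] (hp : 1 ≤ p) (s : ℕ) {n k : ℕ}
    (hpn : p * n < q * q) (hk1 : 1 ≤ k) (hk : k ≤ n) :
    ((phiExp p n q : ℕ) : ℤ) ≤ padicValRat q (RnReg p s n k (-(k : ℚ))) := by
  have hq0 : 0 < q := hq.out.pos
  -- `r_{p-1+s,k} = ± N₁/N₂` with natural numbers `N₁, N₂`
  set N₁ : ℕ := k ^ M0 p s * (n !) ^ s * ((p * k)! * (p * (n - k))!) with hN₁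
  set N₂ : ℕ := (k ! * (n - k)!) ^ (p + s) with hN₂
  have hN₁0 : N₁ ≠ 0 := by
    simp only [hN₁]
    exact mul_ne_zero (mul_ne_zero (pow_ne_zero _ (by omega)) (pow_ne_zero _ (Nat.factorial_ne_zero n)))
      (mul_ne_zero (Nat.factorial_ne_zero _) (Nat.factorial_ne_zero _))
  have hN₂0 : N₂ ≠ 0 := pow_ne_zero _ (mul_ne_zero (Nat.factorial_ne_zero _) (Nat.factorial_ne_zero _))
  have hval : padicValRat q (RnReg p s n k (-(k : ℚ))) = ((padicValNat q N₁ : ℕ) : ℤ) - ((padicValNat q N₂ : ℕ) : ℤ) := by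
    rw [RnReg_neg_eq hp s hk]
    have e : ((k : ℚ) ^ M0 p s * (n ! : ℚ) ^ s * (((p * k)! : ℚ) * ((p * (n - k))! : ℚ)) /
        ((k ! : ℚ) * ((n - k)! : ℚ)) ^ (p + s)) = (N₁ : ℚ) / (N₂ : ℚ) := by
      simp only [hN₁, hN₂]; push_cast; ring
    rw [e, padicValRat.mul (pow_ne_zero _ (by norm_num)) (div_ne_zero (by exact_mod_cast hN₁0) (by exact_mod_cast hN₂0)),
      padicValRat.pow, padicValRat.neg, padicValRat.one, mul_zero, zero_add,
      padicValRat.div (by exact_mod_cast hN₁0) (by exact_mod_cast hN₂0), ← padicValRat_of_nat, ← padicValRat_of_nat]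
  -- the valuations of `N₁`, `N₂`
  have hsq : p * n < q ^ 2 := by rw [sq]; exact hpn
  have hnq : n < q ^ 2 := lt_of_le_of_lt (by nlinarith : n ≤ p * n) hsq
  have v1 : padicValNat q ((p * k)!) = p * k / q :=
    padicValNat_factorial_of_lt_sq (lt_of_le_of_lt (Nat.mul_le_mul_left p hk) hsq)
  have v2 : padicValNat q ((p * (n - k))!) = p * (n - k) / q :=
    padicValNat_factorial_of_lt_sq (lt_of_le_of_lt (Nat.mul_le_mul_left p (Nat.sub_le n k)) hsq)
  have v3 : padicValNat q (k !) = k / q := padicValNat_factorial_of_lt_sq (lt_of_le_of_lt hk hnq)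
  have v4 : padicValNat q ((n - k)!) = (n - k) / q := padicValNat_factorial_of_lt_sq (lt_of_le_of_lt (Nat.sub_le n k) hnq)
  have hchoose : padicValNat q (k !) + padicValNat q ((n - k)!) ≤ padicValNat q (n !) := by
    rw [← padicValNat.mul (Nat.factorial_ne_zero k) (Nat.factorial_ne_zero (n - k))]
    exact padicValNat_le_of_dvd (Nat.factorial_ne_zero n) (Nat.factorial_mul_factorial_dvd_factorial hk)
  have hv₁ : padicValNat q N₁ = M0 p s * padicValNat q k + s * padicValNat q (n !) + (p * k / q + p * (n - k) / q) := by
    simp only [hN₁]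
    rw [padicValNat.mul (mul_ne_zero (pow_ne_zero _ (by omega)) (pow_ne_zero _ (Nat.factorial_ne_zero n)))
      (mul_ne_zero (Nat.factorial_ne_zero _) (Nat.factorial_ne_zero _)),
      padicValNat.mul (pow_ne_zero _ (by omega)) (pow_ne_zero _ (Nat.factorial_ne_zero n)),
      padicValNat.mul (Nat.factorial_ne_zero _) (Nat.factorial_ne_zero _), padicValNat.pow, padicValNat.pow, v1, v2]
  have hv₂ : padicValNat q N₂ = (p + s) * (k / q + (n - k) / q) := by
    simp only [hN₂]
    rw [padicValNat.pow, padicValNat.mul (Nat.factorial_ne_zero _) (Nat.factorial_ne_zero _), v3, v4]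
  have H1 : s * (k / q + (n - k) / q) ≤ s * padicValNat q (n !) := by
    rw [v3, v4] at hchoose; exact Nat.mul_le_mul_left _ hchoose
  have H2 := floor_ineq p hq0 hk
  rw [hval, hv₁, hv₂]
  push_cast
  nlinarith [H1, H2, Nat.zero_le (M0 p s * padicValNat q k)]

/-! ## §3. (5.8) for every `i` via exact-exponent bricks, and Lemmas 5.4–5.5 -/

section Exact

variable {q : ℕ} [hq : Fact q.Prime]

/-- The linear factor `t + j/p + m` of `F_{j/p}` at `−k`: its value `(p(m−k)+j)/p` is non-zero (`1 ≤ j < p`) and has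
`v_q ≤ 1` when `pn < q²` (`m < n`, `k ≤ n`). [cite: LaiLupuSprang2025, Lemma 5.4 (proof: "each term … has q-adic order at least −(m+1)")] -/
theorem linear_value_facts {p n k j m : ℕ} (hp : p.Prime) (hpn : p * n < q * q) (hj : j ∈ Ico 1 p) (hm : m < n)
    (hk : k ≤ n) :
    (-(k : ℚ)) + ((j : ℚ) / p + m) ≠ 0 ∧ padicValRat q ((-(k : ℚ)) + ((j : ℚ) / p + m)) ≤ 1 := by
  have hj' := mem_Ico.1 hj
  have hp0 : (p : ℚ) ≠ 0 := by exact_mod_cast hp.ne_zero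
  set z : ℤ := (p : ℤ) * ((m : ℤ) - k) + j with hz
  have hval : (-(k : ℚ)) + ((j : ℚ) / p + m) = (z : ℚ) / p := by
    rw [hz]; push_cast; field_simp; ring
  have hz0 : z ≠ 0 := by
    intro h
    have : (p : ℤ) ∣ j := ⟨-((m : ℤ) - k), by linarith⟩
    have := Int.le_of_dvd (by exact_mod_cast hj'.1) this
    omega
  have hzabs : |z| < (q : ℤ) ^ 2 := by
    have hpn' : ((p * n : ℕ) : ℤ) < ((q * q : ℕ) : ℤ) := by exact_mod_cast hpn
    push_cast at hpn'
    rw [abs_lt, hz]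
    constructor <;> nlinarith [hj'.1, hj'.2, hm, hk]
  refine ⟨by rw [hval]; exact div_ne_zero (by exact_mod_cast hz0) hp0, ?_⟩
  rw [hval, padicValRat.div (by exact_mod_cast hz0) hp0]
  have h1 : padicValRat q (z : ℚ) ≤ 1 := by
    rw [padicValRat.of_int]; exact_mod_cast padicValInt_le_one_of_abs_lt_sq q hz0 hzabs
  have h2 : (0 : ℤ) ≤ padicValRat q (p : ℚ) := by rw [← padicValRat_of_nat]; positivity
  linarith

/-- **The brick `F_{j/p}` at `−k` with exact exponents** (`pn < q²`, `k ≤ n`, `1 ≤ j < p`).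
[cite: LaiLupuSprang2025, Lemma 5.4 (proof: the factors 1/(t + ν/p) of U)] -/
theorem isDOrdDiv_pBrick_exact {p n k j : ℕ} (hp : p.Prime) (hpn : p * n < q * q) (hj : j ∈ Ico 1 p) (hk : k ≤ n)
    (N : ℕ) : IsDOrdDiv q (padicValRat q (pBrick p j n (-(k : ℚ)))) N (pBrick p j n) (-(k : ℚ)) := by
  have hfac : ∀ m ∈ range n, IsDOrdDiv q (padicValRat q ((-(k : ℚ)) + ((j : ℚ) / p + m))) N
      (fun t : ℚ => t + ((j : ℚ) / p + m)) (-(k : ℚ)) := fun m hm =>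
    isDOrdDiv_add_const_exact (linear_value_facts hp hpn hj (mem_range.1 hm) hk).2 N
  have hfac0 : ∀ m ∈ range n, (-(k : ℚ)) + ((j : ℚ) / p + m) ≠ 0 := fun m hm =>
    (linear_value_facts hp hpn hj (mem_range.1 hm) hk).1
  have hprod := isDOrdDiv_prod_exact (range n) (F := fun (m : ℕ) (t : ℚ) => t + ((j : ℚ) / p + m)) hfac hfac0
  have hc := isDOrdDiv_const_exact (q := q) N (-(k : ℚ)) ((p : ℚ) ^ n * (p : ℚ) ^ (n / (p - 1)) / (n ! : ℚ))
  have hc0 : (p : ℚ) ^ n * (p : ℚ) ^ (n / (p - 1)) / (n ! : ℚ) ≠ 0 := by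
    have hp0 : (p : ℚ) ≠ 0 := by exact_mod_cast hp.ne_zero
    exact div_ne_zero (mul_ne_zero (pow_ne_zero _ hp0) (pow_ne_zero _ hp0)) (by exact_mod_cast Nat.factorial_ne_zero n)
  have h := isDOrdDiv_mul_exact (f := fun _ : ℚ => (p : ℚ) ^ n * (p : ℚ) ^ (n / (p - 1)) / (n ! : ℚ))
    (g := fun t : ℚ => ∏ m ∈ range n, (t + ((j : ℚ) / p + m))) hc hprod hc0 (prod_ne_zero_iff.2 hfac0)
  have e1 : (fun t : ℚ => (fun _ : ℚ => (p : ℚ) ^ n * (p : ℚ) ^ (n / (p - 1)) / (n ! : ℚ)) t *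
      (fun t : ℚ => ∏ m ∈ range n, (t + ((j : ℚ) / p + m))) t) = pBrick p j n := by
    funext t; rw [pBrick]
  have e2 : (fun _ : ℚ => (p : ℚ) ^ n * (p : ℚ) ^ (n / (p - 1)) / (n ! : ℚ)) (-(k : ℚ)) *
      (fun t : ℚ => ∏ m ∈ range n, (t + ((j : ℚ) / p + m))) (-(k : ℚ)) = pBrick p j n (-(k : ℚ)) := by
    rw [pBrick]
  rw [e1, e2] at h
  exact h

/-- `F_{j/p}(−k) ≠ 0`. [cite: LaiLupuSprang2025, Lemma 5.4 (proof, case i = 0)] -/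
theorem pBrick_neg_ne_zero {p n k j : ℕ} (hp : p.Prime) (hj : j ∈ Ico 1 p) (hk : k ≤ n) :
    pBrick p j n (-(k : ℚ)) ≠ 0 := by
  have hp0 : (p : ℚ) ≠ 0 := by exact_mod_cast hp.ne_zero
  refine mul_ne_zero (div_ne_zero (mul_ne_zero (pow_ne_zero _ hp0) (pow_ne_zero _ hp0))
    (by exact_mod_cast Nat.factorial_ne_zero n)) (prod_ne_zero_iff.2 fun m hm => ?_)
  -- `q := p n + p + 1` would do; we only need non-vanishing, which is independent of `q`: reuse the facts with a large prime
  obtain ⟨q', hq', hq'p⟩ := Nat.exists_infinite_primes (p * n + 1)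
  haveI : Fact q'.Prime := ⟨hq'p⟩
  have hpn : p * n < q' * q' := by nlinarith [hq'p.two_le]
  exact (linear_value_facts (q := q') hp hpn hj (mem_range.1 hm) hk).1

/-- **The brick form at `−k` with exact exponents**: `v_q(𝒟_λ(R_n(t)(t+k)^{p−1+s})(−k)) ≥ v_q(r_{p−1+s,k}) − λ` for every
`λ` (`p` prime, `pn < q²`, `1 ≤ k ≤ n`). [cite: LaiLupuSprang2025, Lemma 5.4 (proof: the induction (5.12)–(5.14))] -/
theorem isDOrdDiv_RnReg_exact {p n k : ℕ} (hp : p.Prime) (hpn : p * n < q * q) (s : ℕ) (hk1 : 1 ≤ k) (hk : k ≤ n)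
    (N : ℕ) : IsDOrdDiv q (padicValRat q (RnReg p s n k (-(k : ℚ)))) N (RnReg p s n k) (-(k : ℚ)) := by
  have hnq : n < q * q := lt_of_le_of_lt (Nat.le_mul_of_pos_left n hp.pos) hpn
  -- the four kinds of factors
  have hA := isDOrdDiv_const_exact (q := q) N (-(k : ℚ)) (Acst p n : ℚ)
  have hA0 : (Acst p n : ℚ) ≠ 0 := by
    unfold Acst; exact_mod_cast pow_ne_zero _ hp.ne_zero
  have hk0 : (-(k : ℚ)) + 0 ≠ 0 := by
    rw [add_zero, neg_ne_zero]; exact_mod_cast (show k ≠ 0 by omega)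
  have hT1 : IsDOrdDiv q (padicValRat q ((-(k : ℚ)) + 0)) N (fun t : ℚ => t + 0) (-(k : ℚ)) := by
    refine isDOrdDiv_add_const_exact ?_ N
    rw [add_zero, padicValRat.neg, ← padicValRat_of_nat]
    have hkz : ((k : ℤ)) ≠ 0 := by exact_mod_cast (show k ≠ 0 by omega)
    have h1 := padicValInt_le_one_of_abs_lt_sq q hkz (by
      rw [abs_of_nonneg (by positivity)]
      have : ((n : ℕ) : ℤ) < ((q * q : ℕ) : ℤ) := by exact_mod_cast hnq
      push_cast at this; nlinarith)
    unfold padicValInt at h1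
    simpa using h1
  have hT := isDOrdDiv_pow_exact (f := fun t : ℚ => t + 0) (x := -(k : ℚ)) hT1 (M0 p s)
  have hG := isDOrdDiv_pow_exact (f := Greg n k) (x := -(k : ℚ)) (isDOrdDiv_Greg_exact (q := q) hnq hk N) (p - 1 + s)
  have hF := isDOrdDiv_prod_exact (Ico 1 p) (F := fun (j : ℕ) (t : ℚ) => pBrick p j n t)
    (fun j hj => isDOrdDiv_pBrick_exact hp hpn hj hk N) (fun j hj => pBrick_neg_ne_zero hp hj hk)
  have hT0 : ((-(k : ℚ)) + 0) ^ M0 p s ≠ 0 := pow_ne_zero _ hk0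
  have hG0 : Greg n k (-(k : ℚ)) ^ (p - 1 + s) ≠ 0 := pow_ne_zero _ (Greg_neg_ne_zero hk)
  have hF0 : ∏ j ∈ Ico 1 p, pBrick p j n (-(k : ℚ)) ≠ 0 := prod_ne_zero_iff.2 fun j hj => pBrick_neg_ne_zero hp hj hk
  -- assemble `A · t^{M₀}`, then `· Greg^{p-1+s}`, then `· ∏ F_{j/p}`
  set f1 : ℚ → ℚ := fun _ => (Acst p n : ℚ) with hf1
  set f2 : ℚ → ℚ := fun t => (t + 0) ^ M0 p s with hf2
  set f3 : ℚ → ℚ := fun t => Greg n k t ^ (p - 1 + s) with hf3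
  set f4 : ℚ → ℚ := fun t => ∏ j ∈ Ico 1 p, pBrick p j n t with hf4
  have h12 := isDOrdDiv_mul_exact (f := f1) (g := f2) (x := -(k : ℚ)) hA hT hA0 hT0
  have h123 := isDOrdDiv_mul_exact (f := fun t => f1 t * f2 t) (g := f3) (x := -(k : ℚ)) h12 hG
    (mul_ne_zero hA0 hT0) hG0
  have h := isDOrdDiv_mul_exact (f := fun t => f1 t * f2 t * f3 t) (g := f4) (x := -(k : ℚ)) h123 hF
    (mul_ne_zero (mul_ne_zero hA0 hT0) hG0) hF0
  have e1 : (fun t : ℚ => f1 t * f2 t * f3 t * f4 t) = RnReg p s n k := by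
    funext t; simp only [hf1, hf2, hf3, hf4, add_zero]; rfl
  have e2 : f1 (-(k : ℚ)) * f2 (-(k : ℚ)) * f3 (-(k : ℚ)) * f4 (-(k : ℚ)) = RnReg p s n k (-(k : ℚ)) := by
    simp only [hf1, hf2, hf3, hf4, add_zero]; rfl
  rw [e1, e2] at h
  exact h

end Exact

/-- **(5.8) for every `i`:** `v_q(r_{i,k}) ≥ φ(n/q) − (p−1+s−i)` for `q ∈ phiPrimes p n` and `1 ≤ k ≤ n` (`p` prime).
[cite: LaiLupuSprang2025, Lemma 5.4 (5.8)] -/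
theorem padicOrdGe_coeffR_of_mem_phiPrimes {p : ℕ} (hp : p.Prime) (s : ℕ) {n k i q : ℕ} [Fact q.Prime]
    (hmem : q ∈ phiPrimes p n) (hk1 : 1 ≤ k) (hk : k ≤ n) :
    PadicOrdGe q ((phiExp p n q : ℤ) - ((p - 1 + s - i : ℕ) : ℤ)) (coeffR p s n i k) := by
  have hpn := (mem_phiPrimes.1 hmem).2.2
  have h := (isDOrdDiv_RnReg_exact hp hpn s hk1 hk (p - 1 + s - i)).padicOrdGe le_rfl
  rw [← coeffR] at h
  exact h.mono (by have := phiExp_le_padicValRat_RnReg_neg hp.one_lt.le s hpn hk1 hk; omega)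

/-- At `k = 0` every `r_{i,0}` vanishes (`p ≥ 2`, `s ≥ 1`): the brick form is `t^{M₀}·(smooth)` with `M₀ > p−1+s ≥ p−1+s−i`
(«`t = 0` is not a pole of `R_n(t)`»). [cite: LaiLupuSprang2025, §3 (after Definition 3.2)] -/
theorem coeffR_zero_right {p s : ℕ} (hp : 2 ≤ p) (hs : 1 ≤ s) (n i : ℕ) : coeffR p s n i 0 = 0 := by
  have hlt : p - 1 + s - i < M0 p s := lt_of_le_of_lt (Nat.sub_le _ _) (pole_order_lt_M0 hp hs)
  rw [coeffR]
  have hg : ContDiffAt ℚ ((p - 1 + s - i : ℕ) : WithTop ℕ∞)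
      (fun t : ℚ => (Acst p n : ℚ) * Greg n 0 t ^ (p - 1 + s) * ∏ j ∈ Ico 1 p, pBrick p j n t) (-((0 : ℕ) : ℚ)) := by
    have hG := contDiffAt_Greg n 0 (x := -((0 : ℕ) : ℚ)) (fun l _ hl => by
      push_cast; rw [neg_zero, zero_add]; exact_mod_cast hl) (N := ((p - 1 + s - i : ℕ) : WithTop ℕ∞))
    refine (contDiffAt_const.mul (hG.pow _)).mul (contDiffAt_prod fun j _ => ?_)
    unfold pBrick; fun_prop
  have e : RnReg p s n 0 = fun t : ℚ => (t - (-((0 : ℕ) : ℚ))) ^ M0 p s *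
      ((Acst p n : ℚ) * Greg n 0 t ^ (p - 1 + s) * ∏ j ∈ Ico 1 p, pBrick p j n t) := by
    funext t; rw [RnReg]; push_cast; rw [neg_zero, sub_zero]; ring
  rw [e, divDeriv_sub_pow_mul hg, if_pos hlt]

/-- **Lemma 5.4: `Φ_n^{−1}·d_n^{p−1+s−i}·r_{i,k} ∈ ℤ`** for every `k ≤ n` and every `i` (`p` prime, `s ≥ 1`) — at a prime of
`Φ_n`, `v_q(d_n) = 1` and (5.8); at any other prime, `v_q(Φ_n) = 0` and Lemma 5.3; at `k = 0`, `r_{i,0} = 0`.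
[cite: LaiLupuSprang2025, Lemma 5.4] -/
theorem exists_int_phi_coeffR {p : ℕ} (hp : p.Prime) {s : ℕ} (hs : 1 ≤ s) (n : ℕ) {k : ℕ} (hk : k ≤ n) (i : ℕ) :
    ∃ z : ℤ, (Nat.lcmUpto n : ℚ) ^ (p - 1 + s - i) * coeffR p s n i k / (PhiL p n : ℚ) = z := by
  rcases Nat.eq_zero_or_pos k with rfl | hk1
  · exact ⟨0, by rw [coeffR_zero_right hp.two_le hs]; simp⟩
  refine Rat.exists_int_of_padicOrdGe fun q hq => ?_
  haveI : Fact q.Prime := ⟨hq⟩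
  rw [div_eq_mul_inv]
  by_cases hmem : q ∈ phiPrimes p n
  · have hd : PadicOrdGe q ((p - 1 + s - i : ℕ) : ℤ) ((Nat.lcmUpto n : ℚ) ^ (p - 1 + s - i)) := by
      refine PadicOrdGe.of_eq (le_of_eq ?_)
      rw [padicValRat.pow, ← padicValRat_of_nat, padicValNat_lcmUpto_of_mem_phiPrimes hp.one_lt.le hmem]; simp
    have ha := padicOrdGe_coeffR_of_mem_phiPrimes hp s (i := i) hmem hk1 hk
    have hΦ : PadicOrdGe q (-(phiExp p n q : ℤ)) (((PhiL p n : ℚ))⁻¹) := by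
      refine PadicOrdGe.of_eq (le_of_eq ?_)
      rw [padicValRat.inv, ← padicValRat_of_nat, padicValNat_PhiL_of_mem hmem]
    refine ((hd.mul ha).mul hΦ).mono ?_
    omega
  · obtain ⟨z, hz⟩ := exists_int_lcm_pow_mul_coeffR hp s n hk i
    have hΦ : PadicOrdGe q 0 (((PhiL p n : ℚ))⁻¹) := by
      refine PadicOrdGe.of_eq (le_of_eq ?_)
      rw [padicValRat.inv, ← padicValRat_of_nat, padicValNat_PhiL_of_not_mem hmem]; simp
    have hz' : PadicOrdGe q 0 ((Nat.lcmUpto n : ℚ) ^ (p - 1 + s - i) * coeffR p s n i k) := by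
      rw [hz]; exact PadicOrdGe.of_int z
    simpa using hz'.mul hΦ

/-- **Lemma 5.5: `Φ_n^{−1}·d_n^{p−1+s−i}·ρ_i ∈ ℤ`** (`p` prime, `s ≥ 1`). [cite: LaiLupuSprang2025, Lemma 5.5] -/
theorem exists_int_phi_rho {p : ℕ} (hp : p.Prime) {s : ℕ} (hs : 1 ≤ s) (n i : ℕ) :
    ∃ z : ℤ, (Nat.lcmUpto n : ℚ) ^ (p - 1 + s - i) * rho p s n i / (PhiL p n : ℚ) = z := by
  have h : ∀ k ∈ range (n + 1), ∃ z : ℤ,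
      (Nat.lcmUpto n : ℚ) ^ (p - 1 + s - i) * coeffR p s n i k / (PhiL p n : ℚ) = z :=
    fun k hk => exists_int_phi_coeffR hp hs n (by have := mem_range.1 hk; omega) i
  choose! z hz using h
  refine ⟨∑ k ∈ range (n + 1), z k, ?_⟩
  rw [rho, mul_sum, sum_div]
  push_cast
  exact sum_congr rfl hz

/-- In particular `Φ_n^{−1}·d_n^{p−1+s}·ρ_i ∈ ℤ`. [cite: LaiLupuSprang2025, §8 (proof of Thm 1.1: "ρ̂_i ∈ ℤ for all i")] -/
theorem exists_int_phi_rho' {p : ℕ} (hp : p.Prime) {s : ℕ} (hs : 1 ≤ s) (n i : ℕ) :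
    ∃ z : ℤ, (Nat.lcmUpto n : ℚ) ^ (p - 1 + s) * rho p s n i / (PhiL p n : ℚ) = z := by
  obtain ⟨z, hz⟩ := exists_int_phi_rho hp hs n i
  refine ⟨(Nat.lcmUpto n : ℤ) ^ (p - 1 + s - (p - 1 + s - i)) * z, ?_⟩
  push_cast
  rw [← hz, ← mul_div_assoc, ← mul_assoc, ← pow_add]
  congr 3
  omega

/-! ## §4. Lemma 5.6 (the root relation and "no two bad shifts") and Lemma 5.7 -/

/-- **The inner sums of `ρ_{0,j/p}`:** `X_k(y) := Σ_{i=1}^{p−1+s} r_{i,k} y^{−i}`. [cite: LaiLupuSprang2025, Lemma 5.6 (proof: "the most inner sum")] -/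
def XtermR (p s n k : ℕ) (y : ℚ) : ℚ := ∑ i ∈ Icc 1 (p - 1 + s), coeffR p s n i k * (y ^ i)⁻¹

/-- `ρ_{0,j/p} = −Σ_{k ≤ n} Σ_{ν<k} X_k(ν + j/p)`. [cite: LaiLupuSprang2025, Lemma 4.3 (4.4)] -/
theorem rhoZeroJ_eq (p s n j : ℕ) :
    rhoZeroJ p s n j = -∑ k ∈ range (n + 1), ∑ ν ∈ range k, XtermR p s n k ((ν : ℚ) + (j : ℚ) / p) := by
  rw [rhoZeroJ, Finset.sum_comm]
  congr 1
  refine sum_congr rfl fun k _ => ?_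
  rw [Finset.sum_comm]
  refine sum_congr rfl fun ν _ => sum_congr rfl fun i _ => ?_
  rw [div_eq_mul_inv]

/-- **`R_n(j/p − m) = 0`** for `1 ≤ j < p` and `1 ≤ m ≤ n`: the factor `t + (p−j)/p + (m−1)` of `(t + (p−j)/p)_n` vanishes
there. [cite: LaiLupuSprang2025, Lemma 5.6 (proof: "the linear polynomial t + k₀ − ν₀ − 1 + (p−j)/p is a factor of R_n(t)")] -/
theorem Rn_eq_zero_of_root (p s n : ℕ) {j m : ℕ} (hj : j ∈ Ico 1 p) (hm1 : 1 ≤ m) (hmn : m ≤ n) :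
    Rn p s n ((j : ℚ) / p - m) = 0 := by
  have hj' := mem_Ico.1 hj
  have hp0 : (p : ℚ) ≠ 0 := by exact_mod_cast (show p ≠ 0 by omega)
  have hzero : ∏ j' ∈ Ico 1 p, ∏ m' ∈ range n, ((j : ℚ) / p - m + (((j' : ℚ)) / p + m')) = 0 := by
    refine prod_eq_zero (i := p - j) (mem_Ico.2 ⟨by omega, by omega⟩) (prod_eq_zero (i := m - 1) (mem_range.2 (by omega)) ?_)
    rw [Nat.cast_sub hj'.2.le, Nat.cast_sub hm1]
    field_simp
    ring
  rw [Rn, hzero, mul_zero, zero_div]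

/-- **The root relation:** `Σ_{k ≤ n} X_k(j/p − m + k) = 0` for `1 ≤ j < p`, `1 ≤ m ≤ n` (through (def:r_ik) at the
non-pole `t = j/p − m`; `p` prime, degree condition). [cite: LaiLupuSprang2025, Lemma 5.6 (proof: "It follows from (def:r_ik) that …")] -/
theorem sum_XtermR_root_eq_zero {p : ℕ} (hp : p.Prime) (s n : ℕ) (hdeg : M0 p s + (p - 1) * n < (p - 1 + s) * (n + 1))
    {j m : ℕ} (hj : j ∈ Ico 1 p) (hm1 : 1 ≤ m) (hmn : m ≤ n) :
    ∑ k ∈ range (n + 1), XtermR p s n k ((j : ℚ) / p - m + k) = 0 := by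
  have hj' := mem_Ico.1 hj
  have hx : ∀ k ∈ range (n + 1), (j : ℚ) / p - m + k ≠ 0 := by
    intro k _ h
    have hp0 : (p : ℚ) ≠ 0 := by exact_mod_cast hp.ne_zero
    have h2 : ((j : ℤ) + p * ((k : ℤ) - m) : ℤ) = 0 := by
      have : (j : ℚ) + p * ((k : ℚ) - m) = 0 := by
        have := congrArg (fun x => x * (p : ℚ)) h
        simp only [zero_mul] at this
        rw [← this]; field_simp; ring
      exact_mod_cast this
    have : (p : ℤ) ∣ j := ⟨-((k : ℤ) - m), by linarith⟩
    have := Int.le_of_dvd (by exact_mod_cast hj'.1) this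
    omega
  have h := Rn_eq_sum_coeffR hp.one_lt.le s n hdeg hx
  rw [Rn_eq_zero_of_root p s n hj hm1 hmn] at h
  rw [h]
  refine sum_congr rfl fun k _ => ?_
  rw [XtermR]

/-- **No two bad shifts:** for `k ≠ k'` in `[0, n]`, a prime power `Q = q^{⌊log_q n⌋+1}` cannot divide both `pν + j` and
`p(k' − k + ν) + j` (`1 ≤ j < p`, `p` prime): it would be prime to `p` (as `p ∤ j`) and divide `p(k'−k)`, hence `k' − k`,
but `0 < |k' − k| ≤ n < Q`. [cite: LaiLupuSprang2025, Lemma 5.6 (proof: "hence v_q(k₁−k₀) > v_q(d_n). But this contradicts 0 < |k₁−k₀| ≤ n")] -/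
theorem not_dvd_both_p {p : ℕ} (hp : p.Prime) (q : ℕ) [hq : Fact q.Prime] (n : ℕ) {k k' : ℕ} (hk : k ≤ n) (hk' : k' ≤ n)
    (hne : k' ≠ k) {j : ℕ} (hj : j ∈ Ico 1 p) (ν : ℕ)
    (h1 : (((q ^ (Nat.log q n + 1) : ℕ)) : ℤ) ∣ ((p : ℤ) * ν + j))
    (h2 : (((q ^ (Nat.log q n + 1) : ℕ)) : ℤ) ∣ ((p : ℤ) * ((k' : ℤ) - k + ν) + j)) : False := by
  have hj' := mem_Ico.1 hj
  set Q : ℕ := q ^ (Nat.log q n + 1) with hQ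
  -- `q ≠ p`, since `q ∣ pν + j` would give `p ∣ j`
  have hqp : q ≠ p := by
    intro hqp
    have hq1 : (p : ℤ) ∣ (Q : ℤ) := by
      rw [hQ, hqp]; push_cast; exact dvd_pow_self _ (by omega)
    have h3 : (p : ℤ) ∣ (p : ℤ) * ν + j := hq1.trans h1
    have h4 : (p : ℤ) ∣ j := by
      have := dvd_sub h3 (dvd_mul_right (p : ℤ) ν)
      rwa [add_sub_cancel_left] at this
    have := Int.le_of_dvd (by exact_mod_cast hj'.1) h4
    omega
  have hcop : IsCoprime (Q : ℤ) (p : ℤ) := by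
    rw [hQ, Int.isCoprime_iff_gcd_eq_one, Int.gcd_natCast_natCast]
    exact Nat.Coprime.pow_left _ ((Nat.coprime_primes hq.out hp).2 hqp)
  -- `Q ∣ p(k' − k)`, hence `Q ∣ k' − k`
  have hdiff : (Q : ℤ) ∣ (p : ℤ) * ((k' : ℤ) - k) := by
    have := dvd_sub h2 h1
    have e : ((p : ℤ) * ((k' : ℤ) - k + ν) + j) - ((p : ℤ) * ν + j) = (p : ℤ) * ((k' : ℤ) - k) := by ring
    rwa [e] at this
  have hdvd : (Q : ℤ) ∣ ((k' : ℤ) - k) := hcop.dvd_of_dvd_mul_left hdiff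
  have hQn : n < Q := Nat.lt_pow_succ_log_self hq.out.one_lt n
  have habs := Int.le_of_dvd (by
    have : ((k' : ℤ) - k) ≠ 0 := sub_ne_zero.2 (by exact_mod_cast hne)
    exact abs_pos.2 this) ((dvd_abs _ _).2 hdvd)
  have hle : |((k' : ℤ) - k)| ≤ n := by
    rw [abs_le]; constructor <;> omega
  have : (Q : ℤ) ≤ n := habs.trans hle
  omega

/-- `q`-integrality of one refined term: if `‖d_n/N‖_q ≤ 1` then `‖Φ_n^{−1}d_n^{p−1+s}·X_k(N/p)‖_q ≤ 1` (`k ≤ n`), since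
`Φ_n^{−1}d_n^{p−1+s} r_{i,k} (N/p)^{−i} = (Φ_n^{−1}d_n^{p−1+s−i} r_{i,k}) · p^i · (d_n/N)^i` with
`Φ_n^{−1}d_n^{p−1+s−i}r_{i,k} ∈ ℤ` (Lemma 5.4). [cite: LaiLupuSprang2025, Lemma 5.6 (proof: "by Lemma 5.4 we have v_q(Φ_n^{−1}d_n^{p−1+s−i₀}r_{i₀,k₀}) ≥ 0")] -/
theorem padicNorm_phi_lcm_pow_mul_XtermR_le {p : ℕ} (hp : p.Prime) {s : ℕ} (hs : 1 ≤ s) (q : ℕ) [Fact q.Prime] (n : ℕ)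
    {k : ℕ} (hk : k ≤ n) {N : ℤ} (hN : N ≠ 0) (hle : padicNorm q ((Nat.lcmUpto n : ℚ) / N) ≤ 1) :
    padicNorm q ((Nat.lcmUpto n : ℚ) ^ (p - 1 + s) * XtermR p s n k ((N : ℚ) / p) / (PhiL p n : ℚ)) ≤ 1 := by
  have hN' : (N : ℚ) ≠ 0 := by exact_mod_cast hN
  have hp0 : (p : ℚ) ≠ 0 := by exact_mod_cast hp.ne_zero
  have hΦ : (PhiL p n : ℚ) ≠ 0 := PhiL_cast_ne_zero p n
  rw [XtermR, mul_sum, sum_div]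
  refine padicNorm.sum_le' (fun i hi => ?_) zero_le_one
  have hi' := mem_Icc.1 hi
  obtain ⟨z, hz⟩ := exists_int_phi_coeffR hp hs n hk i
  set d : ℚ := (Nat.lcmUpto n : ℚ) with hd
  have e : d ^ (p - 1 + s) = d ^ (p - 1 + s - i) * d ^ i := by
    rw [← pow_add]; congr 1; omega
  have hexp : d ^ (p - 1 + s) * (coeffR p s n i k * ((((N : ℚ) / p)) ^ i)⁻¹) / (PhiL p n : ℚ) =
      (z : ℚ) * (p : ℚ) ^ i * (d / N) ^ i := by
    have step1 : d ^ (p - 1 + s) * (coeffR p s n i k * ((((N : ℚ) / p)) ^ i)⁻¹) / (PhiL p n : ℚ) =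
        (d ^ (p - 1 + s - i) * coeffR p s n i k / (PhiL p n : ℚ)) * (d ^ i * ((((N : ℚ) / p)) ^ i)⁻¹) := by
      rw [e]; ring
    rw [step1, hz, ← inv_pow, ← mul_pow, show d * (((N : ℚ) / p))⁻¹ = p * (d / N) by field_simp, mul_pow]
    ring
  rw [hexp, padicNorm.mul, padicNorm.mul, IsAbsoluteValue.abv_pow (padicNorm q), IsAbsoluteValue.abv_pow (padicNorm q)]
  refine mul_le_one₀ (mul_le_one₀ (padicNorm.of_int _) (pow_nonneg (padicNorm.nonneg _) _)
    (pow_le_one₀ (padicNorm.nonneg _) (padicNorm.of_nat _))) (pow_nonneg (padicNorm.nonneg _) _)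
    (pow_le_one₀ (padicNorm.nonneg _) hle)

/-- **Each term of `ρ_{0,j/p}` is `Φ_n^{−1}d_n^{p−1+s}`-integral:** `Φ_n^{−1}d_n^{p−1+s}·X_k(ν + j/p) ∈ ℤ` for
`0 ≤ ν < k ≤ n`, `1 ≤ j < p` — at a prime `q` with `v_q(pν+j) ≤ v_q(d_n)` directly, otherwise through the root relation at
`m = k − ν`, all of whose other terms are `q`-integral (no two bad shifts): the printed argument by contradiction.
[cite: LaiLupuSprang2025, Lemma 5.6 (proof)] -/
theorem exists_int_phi_XtermR {p : ℕ} (hp : p.Prime) {s : ℕ} (hs : 1 ≤ s) (n : ℕ)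
    (hdeg : M0 p s + (p - 1) * n < (p - 1 + s) * (n + 1)) {j : ℕ} (hj : j ∈ Ico 1 p) {k ν : ℕ} (hk : k ≤ n)
    (hν : ν < k) :
    ∃ z : ℤ, (z : ℚ) = (Nat.lcmUpto n : ℚ) ^ (p - 1 + s) * XtermR p s n k ((ν : ℚ) + (j : ℚ) / p) / (PhiL p n : ℚ) := by
  have hj' := mem_Ico.1 hj
  have hp0 : (p : ℚ) ≠ 0 := by exact_mod_cast hp.ne_zero
  refine Literature.Algebra.Module.Rat.exists_int_eq_of_forall_padicNorm_le_one _ fun q hq => ?_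
  haveI : Fact q.Prime := ⟨hq⟩
  have hN : ((p : ℤ) * ν + j : ℤ) ≠ 0 := by
    have : (0 : ℤ) < (p : ℤ) * ν + j := by have := hj'.1; positivity
    exact this.ne'
  have hy : ((ν : ℚ) + (j : ℚ) / p) = ((((p : ℤ) * ν + j : ℤ)) : ℚ) / p := by push_cast; field_simp
  by_cases hgood : padicNorm q ((Nat.lcmUpto n : ℚ) / (((p : ℤ) * ν + j : ℤ) : ℚ)) ≤ 1
  · rw [hy]
    exact padicNorm_phi_lcm_pow_mul_XtermR_le hp hs q n hk hN hgood
  · -- the bad case: use the root relation at `m = k − ν`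
    have hbad := pow_log_succ_dvd_of_one_lt_padicNorm q n hN (not_le.1 hgood)
    have hm1 : 1 ≤ k - ν := by omega
    have hmn : k - ν ≤ n := by omega
    have hroot := sum_XtermR_root_eq_zero hp s n hdeg hj hm1 hmn
    rw [← add_sum_erase _ _ (mem_range.2 (by omega : k < n + 1))] at hroot
    have hkk : (j : ℚ) / p - ((k - ν : ℕ) : ℚ) + k = (ν : ℚ) + (j : ℚ) / p := by
      rw [Nat.cast_sub hν.le]; ring
    rw [hkk] at hroot
    have hX : (Nat.lcmUpto n : ℚ) ^ (p - 1 + s) * XtermR p s n k ((ν : ℚ) + (j : ℚ) / p) / (PhiL p n : ℚ) =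
        -∑ k' ∈ (range (n + 1)).erase k,
          (Nat.lcmUpto n : ℚ) ^ (p - 1 + s) * XtermR p s n k' ((j : ℚ) / p - ((k - ν : ℕ) : ℚ) + k') /
            (PhiL p n : ℚ) := by
      rw [← sum_div, ← mul_sum, ← neg_div, ← mul_neg]
      congr 2
      linarith
    rw [hX, padicNorm.neg]
    refine padicNorm.sum_le' (fun k' hk' => ?_) zero_le_one
    have hk'k : k' ≠ k := (mem_erase.1 hk').1
    have hk'n : k' ≤ n := by have := mem_range.1 (mem_of_mem_erase hk'); omega
    have hN' : ((p : ℤ) * ((k' : ℤ) - k + ν) + j : ℤ) ≠ 0 := by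
      intro h
      have : (p : ℤ) ∣ j := ⟨-((k' : ℤ) - k + ν), by linarith⟩
      have := Int.le_of_dvd (by exact_mod_cast hj'.1) this
      omega
    have hy' : (j : ℚ) / p - ((k - ν : ℕ) : ℚ) + k' = ((((p : ℤ) * ((k' : ℤ) - k + ν) + j : ℤ)) : ℚ) / p := by
      rw [Nat.cast_sub hν.le]; push_cast; field_simp; ring
    rw [hy']
    refine padicNorm_phi_lcm_pow_mul_XtermR_le hp hs q n hk'n hN' ?_
    by_contra hgt
    exact not_dvd_both_p hp q n hk hk'n hk'k hj ν hbad (pow_log_succ_dvd_of_one_lt_padicNorm q n hN' (not_le.1 hgt))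

/-- **Lemma 5.6: `Φ_n^{−1}·d_n^{p−1+s}·ρ_{0,j/p} ∈ ℤ`** (`1 ≤ j < p`; `p` prime, `s ≥ 1`, degree condition).
[cite: LaiLupuSprang2025, Lemma 5.6] -/
theorem exists_int_phi_rhoZeroJ {p : ℕ} (hp : p.Prime) {s : ℕ} (hs : 1 ≤ s) (n : ℕ)
    (hdeg : M0 p s + (p - 1) * n < (p - 1 + s) * (n + 1)) {j : ℕ} (hj : j ∈ Ico 1 p) :
    ∃ z : ℤ, (Nat.lcmUpto n : ℚ) ^ (p - 1 + s) * rhoZeroJ p s n j / (PhiL p n : ℚ) = z := by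
  have h : ∀ k ∈ range (n + 1), ∀ ν ∈ range k, ∃ z : ℤ,
      (z : ℚ) = (Nat.lcmUpto n : ℚ) ^ (p - 1 + s) * XtermR p s n k ((ν : ℚ) + (j : ℚ) / p) / (PhiL p n : ℚ) :=
    fun k hk ν hν => exists_int_phi_XtermR hp hs n hdeg hj (by have := mem_range.1 hk; omega) (mem_range.1 hν)
  choose! z hz using h
  refine ⟨-∑ k ∈ range (n + 1), ∑ ν ∈ range k, z k ν, ?_⟩
  rw [rhoZeroJ_eq, mul_neg, neg_div, mul_sum, sum_div]
  push_cast
  congr 1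
  refine sum_congr rfl fun k hk => ?_
  rw [mul_sum, sum_div]
  exact sum_congr rfl fun ν hν => (hz k hk ν hν).symm

/-- **Lemma 5.7: `Φ_n^{−1}·d_n^{p−1+s}·ρ_0 ∈ ℤ`** (`p` prime, `s ≥ 1`, degree condition). [cite: LaiLupuSprang2025, Lemma 5.7] -/
theorem exists_int_phi_rhoZero {p : ℕ} (hp : p.Prime) {s : ℕ} (hs : 1 ≤ s) (n : ℕ)
    (hdeg : M0 p s + (p - 1) * n < (p - 1 + s) * (n + 1)) :
    ∃ z : ℤ, (Nat.lcmUpto n : ℚ) ^ (p - 1 + s) * rhoZero p s n / (PhiL p n : ℚ) = z := by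
  have h : ∀ j ∈ Ico 1 p, ∃ z : ℤ, (Nat.lcmUpto n : ℚ) ^ (p - 1 + s) * rhoZeroJ p s n j / (PhiL p n : ℚ) = z :=
    fun j hj => exists_int_phi_rhoZeroJ hp hs n hdeg hj
  choose! z hz using h
  refine ⟨∑ j ∈ Ico 1 p, z j, ?_⟩
  rw [rhoZero, mul_sum, sum_div]
  push_cast
  exact sum_congr rfl hz

end Literature.NumberTheory.Irrationality.LaiLupuSprang2025
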